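import Summits.Ventures.HSemireg.WedgePointPairPowersPerQDegreeTwo

/-!
# Venture HSemireg — per-`q` blocks of the `n`-fold box of `m`-dimensional point pairs, companion: THE BULK LAW — away from the
# two ends the degree-`k` per-`q` row is `m`-PERIODIC in `q` (window-free shape expansion), for EVERY `m ≥ 1`, `n`, `k`

HONEST FRAMING. Part of the Lean index of the computation cell `pub-hsemireg` (seat p10 gen 5, Sunday typer «UNIFORM-IN-n»).
Natural-number arithmetic of p10's enumerator `genCount` + the rank theorem of `WedgePointPairPowersPerQRank.lean` ONLY: no variety,
no cohomology theory, no sheaf, no Ext group, no semiregularity map is constructed here; nothing here says that HC / HC_CM / HC_AV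
holds; no Literature fact is declared or used.  Custodian versions: STRUCTURE.md v1.0-SIGNED 9b196a05977dd067 (§1.1 C13), theory/FORMULA-N.md
PART A §4.1″ (th-6) / PART B §G (th-7).  Dictionary quoted, not asserted.

THIS FILE, uniformly in `m`, `n` AND the degree `k`, on top of the SHAPE EXPANSION `WedgePointPairPowersPerQDegreeTwo.genCount_eq_sum_shapes`
(`genCount m n k q = Σ_{p ≤ k} C(n,p) Σ_{j < n+1−p, mj ≤ q} [t^k u^{q−mj}] R_m^p`):
§1 the `u`-degree bound: a canonical non-empty source has `q`-part `≤ m − 1`, so **`[t^k u^r] R_m^p = 0` for `r > p(m − 1)`**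
(`atomR_eq_zero_of_lt`, `rbPow_eq_zero_of_mul_lt`);
§2 WINDOW INACTIVITY: for `q + mk ≤ mn` every shift `j` with `mj ≤ q` fits into the `n − p ≥ n − k` empty blocks, so
**`genCount m n k q = Σ_{p ≤ k} C(n,p) Σ_{j ≤ q/m} [t^k u^{q−mj}] R_m^p`** — `n` enters only through the binomials `C(n,p)`
(`genCount_eq_sum_shapes_of_le`);
§3 **THE BULK PERIODICITY THEOREM**: for `k(m−1) ≤ q` and `q + m(k+1) ≤ mn`, **`genCount m n k (q + m) = genCount m n k q`** — the new
shift term `[t^k u^{q+m}] R_m^p` vanishes by §1 (`genCount_add_period`); as a RANK statement for every field and `a, c ≠ 0`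
(`finrank_range_blockProj_wedge_pairBox_add_period`) and as th-7's class count; so every per-`q` row reads: a LEFT EDGE `q < k(m−1)`,
an `m`-PERIODIC BULK `k(m−1) ≤ q ≤ m(n−k)`, and the RIGHT EDGE mirrored by the palindrome of `…PerQSymm`; e.g. `m = 3`, `k = 2`:
`n = 5` `(105,15,180 | 105,105,180,105,105,180,105,105,180 | 15,105,0,0)`, `n = 6` `(153,18,270 | 153,153,270,…,153,153,270 | 18,153,0,0)`
(`bulk_rows`, from the degree-2 closed form).
§4 THE THREE BULK VALUES OF THE `Ext²`-ROW, every `m ≥ 3`, `t + 2 ≤ n`: `n·C(m,2) + C(n,2)·m²` at `q = mt` and at `q = mt + m − 2`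
(`t ≥ 1`), `2·C(n,2)·m² = n(n−1)m²` at `q = mt + m − 1` (`genCount_two_bulk_zero` / `_neg_two` / `_neg_one`; the other residues are
`0` by the support law of `WedgePointPairPowersPerQResidues`) — polynomials in `n` of degree `2`, the uniform-in-`n` shape of the
degree-2 columns (`(105, 105, 180)` at `m = 3`, `n = 5`; `(153, 153, 270)` at `n = 6`).
WHAT IS NOT HERE: the bulk VALUES in closed form beyond degree `2` (they are `Σ_p C(n,p)·T_p(q mod m)`, `T_p(ρ) = Σ_{r ≡ ρ} [t^k u^r]R_m^p`,
polynomials in `n` of degree `≤ k` — stated here only through §2); anything Ext-side.  Namespaces `Summit.Ventures.HSemireg.FormulaN.Uniform`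
(arithmetic) and `Summit.Ventures.HSemireg.Wedge.PairPowers` (rank form); new names only, no definition; a LEAF over
`WedgePointPairPowersPerQDegreeTwo.lean`.
-/

open Finset

namespace Summit.Ventures.HSemireg.FormulaN.Uniform

/-! ## §1. The `u`-degree bound `[t^k u^r] R_m^p = 0` for `r > p(m − 1)` -/

/-- the atom of `R_m` has `q`-part `≤ m − 1` (`0` for the global component, `m − j` with `1 ≤ j` for the local one). -/
theorem atomR_eq_zero_of_lt {m b r : ℕ} (h : m - 1 < r) : atomR m b r = 0 := by
  rw [atomR, qAtom]
  split_ifs <;> omega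

/-- **`[t^k u^r] R_m^p = 0` for `r > p(m − 1)`** (induction on `p`: the last factor carries `q`-part `≤ m − 1`). -/
theorem rbPow_eq_zero_of_mul_lt (m : ℕ) : ∀ p k r : ℕ, p * (m - 1) < r → rbPow m p k r = 0
  | 0, k, r, h => by
    rw [rbPow, if_neg]
    rintro ⟨-, hr⟩
    omega
  | p + 1, k, r, h => by
    rw [rbPow]
    refine Finset.sum_eq_zero fun ab _ => Finset.sum_eq_zero fun pr hpr => ?_
    rw [Finset.HasAntidiagonal.mem_antidiagonal] at hpr
    rcases Nat.lt_or_ge (p * (m - 1)) pr.1 with h1 | h1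
    · rw [rbPow_eq_zero_of_mul_lt m p ab.1 pr.1 h1, zero_mul]
    · have h2 : m - 1 < pr.2 := by
        rw [Nat.succ_mul] at h
        omega
      rw [atomR_eq_zero_of_lt h2, mul_zero]

/-! ## §2. Window inactivity: for `q + mk ≤ mn` the shift window never cuts -/

/-- for `q + mk ≤ mn` and `p ≤ k`, the shifts `j < n + 1 − p` with `mj ≤ q` are exactly the `j ≤ q/m` (`m ≥ 1`). -/
theorem sum_shift_window_eq {m : ℕ} (hm : 1 ≤ m) {n k q p : ℕ} (hq : q + m * k ≤ m * n) (hp : p ≤ k) (g : ℕ → ℕ) :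
    ∑ j ∈ range (n + 1 - p), (if m * j ≤ q then g (q - m * j) else 0) = ∑ j ∈ range (q / m + 1), g (q - m * j) := by
  rw [← Finset.sum_filter]
  refine Finset.sum_congr ?_ fun _ _ => rfl
  ext j
  simp only [Finset.mem_filter, Finset.mem_range, Nat.lt_succ_iff]
  constructor
  · rintro ⟨-, h⟩
    rw [mul_comm] at h
    exact (Nat.le_div_iff_mul_le (by omega)).mpr h
  · intro h
    have h' : j * m ≤ q := (Nat.le_div_iff_mul_le (by omega)).mp h
    rw [mul_comm] at h'
    refine ⟨?_, h'⟩
    have h1 : m * (j + k) ≤ m * n := by rw [mul_add]; omega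
    have h2 : j + k ≤ n := Nat.le_of_mul_le_mul_left h1 (by omega)
    omega

/-- **WINDOW INACTIVITY**: for `q + mk ≤ mn`, `genCount m n k q = Σ_{p ≤ k} C(n,p) · Σ_{j ≤ q/m} [t^k u^{q−mj}] R_m^p` — `n` enters only
through the binomial coefficients (`m ≥ 1`). -/
theorem genCount_eq_sum_shapes_of_le {m : ℕ} (hm : 1 ≤ m) {n k q : ℕ} (hq : q + m * k ≤ m * n) :
    genCount m n k q = ∑ p ∈ range (k + 1), n.choose p * ∑ j ∈ range (q / m + 1), rbPow m p k (q - m * j) := by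
  rw [genCount_eq_sum_shapes]
  refine Finset.sum_congr rfl fun p hp => ?_
  rw [sum_shift_window_eq hm hq (Nat.lt_succ_iff.mp (mem_range.mp hp)) (rbPow m p k)]

/-! ## §3. THE BULK PERIODICITY THEOREM -/

/-- one period further in the bulk: the shift sum gains exactly the term `[t^k u^{q+m}] R_m^p`, which is `0` for `q ≥ k(m−1)`, `p ≤ k`
(`m ≥ 1`). -/
theorem sum_shift_add_period {m : ℕ} (hm : 1 ≤ m) {k q p : ℕ} (hp : p ≤ k) (hkq : k * (m - 1) ≤ q) :
    ∑ j ∈ range ((q + m) / m + 1), rbPow m p k (q + m - m * j) = ∑ j ∈ range (q / m + 1), rbPow m p k (q - m * j) := by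
  rw [Nat.add_div_right q (by omega : 0 < m), Finset.sum_range_succ', mul_zero, Nat.sub_zero,
    rbPow_eq_zero_of_mul_lt m p k (q + m) (by nlinarith [Nat.mul_le_mul_right (m - 1) hp]), add_zero]
  refine Finset.sum_congr rfl fun j _ => ?_
  rw [Nat.mul_succ, show q + m - (m * j + m) = q - m * j by omega]

/-- **THE BULK PERIODICITY THEOREM, UNIFORM IN `m`, `n` AND `k`** (arithmetic form): for `m ≥ 1`, `k(m−1) ≤ q` and
`q + m(k+1) ≤ mn`, **`genCount m n k (q + m) = genCount m n k q`** — in the bulk `k(m−1) ≤ q ≤ m(n−k)` the degree-`k` per-`q`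
row is `m`-periodic. -/
theorem genCount_add_period {m : ℕ} (hm : 1 ≤ m) {n k q : ℕ} (hkq : k * (m - 1) ≤ q) (hq : q + m + m * k ≤ m * n) :
    genCount m n k (q + m) = genCount m n k q := by
  rw [genCount_eq_sum_shapes_of_le hm (q := q + m) hq, genCount_eq_sum_shapes_of_le hm (q := q) (by omega)]
  refine Finset.sum_congr rfl fun p hp => ?_
  rw [sum_shift_add_period hm (Nat.lt_succ_iff.mp (mem_range.mp hp)) hkq]

/-- iterated: **`genCount m n k (q + mi) = genCount m n k q`** as long as `q + mi + mk ≤ mn` (`m ≥ 1`, `k(m−1) ≤ q`). -/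
theorem genCount_add_mul_period {m : ℕ} (hm : 1 ≤ m) {n k q : ℕ} (hkq : k * (m - 1) ≤ q) :
    ∀ i : ℕ, q + m * i + m * k ≤ m * n → genCount m n k (q + m * i) = genCount m n k q
  | 0, _ => by rw [mul_zero, add_zero]
  | i + 1, h => by
    rw [Nat.mul_succ, ← add_assoc, genCount_add_period hm (by omega) (by rw [Nat.mul_succ] at h; omega)]
    exact genCount_add_mul_period hm hkq i (by rw [Nat.mul_succ] at h; omega)

/-- the rows of record with a visible bulk (degree 2, threefold factors): `n = 5`: `(105,15,180,105,105,180,105,105,180,105,105,180,15,105,0,0)`,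
`n = 6`: `(153,18,270,153,153,270,153,153,270,153,153,270,153,153,270,18,153,0,0)` — left edge `q < k(m−1) = 4` (here the period already
holds from `q = 3`), `3`-periodic bulk, mirrored right edge (from the degree-2 closed form `genCount_two_closed`). -/
theorem bulk_rows :
    (List.range 16).map (fun q => genCount 3 5 2 q) = [105, 15, 180, 105, 105, 180, 105, 105, 180, 105, 105, 180, 15, 105, 0, 0] ∧
    (List.range 19).map (fun q => genCount 3 6 2 q) =
      [153, 18, 270, 153, 153, 270, 153, 153, 270, 153, 153, 270, 153, 153, 270, 18, 153, 0, 0] := by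
  simp only [genCount_two_closed (show 1 ≤ 3 by norm_num)]
  decide

/-! ## §4. The three bulk values of the degree-2 (`Ext²`) row, every `m ≥ 3`, `n` -/

/-- a multiple of `m` is not `r` more than a multiple of `m` for `0 < r < m`. -/
theorem mul_ne_add_mul {m r : ℕ} (hr : 0 < r) (hrm : r < m) (t j : ℕ) : m * t ≠ r + m * j := by
  intro h
  rcases Nat.lt_or_ge j t with hjt | hjt
  · have h1 : m * (j + 1) ≤ m * t := Nat.mul_le_mul_left m hjt
    rw [Nat.mul_succ] at h1
    omega
  · have h1 : m * t ≤ m * j := Nat.mul_le_mul_left m hjt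
    omega

/-- **BULK VALUE at `q ≡ 0 (mod m)`**: `genCount m n 2 (mt) = n·C(m,2) + C(n,2)·m²` for `m ≥ 3`, `t + 2 ≤ n` (one `Y`-pair ·or· two
`Y`-letters; from `t = 0`, where it is `C(mn, 2)`). -/
theorem genCount_two_bulk_zero {m : ℕ} (hm : 3 ≤ m) {n t : ℕ} (ht : t + 2 ≤ n) :
    genCount m n 2 (m * t) = n * m.choose 2 + n.choose 2 * (m * m) := by
  rw [genCount_two_closed (by omega),
    if_pos (show ∃ j, j < n ∧ m * t = m * j from ⟨t, by omega, rfl⟩),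
    if_neg (show ¬ (2 < m ∧ ∃ j, j < n ∧ m * t = m - 2 + m * j) from
      fun ⟨_, j, _, h⟩ => mul_ne_add_mul (m := m) (by omega) (by omega) t j h),
    if_pos (show ∃ j, j < n - 1 ∧ m * t = m * j from ⟨t, by omega, rfl⟩),
    if_neg (show ¬ (1 < m ∧ ∃ j, j < n - 1 ∧ m * t = m - 1 + m * j) from
      fun ⟨_, j, _, h⟩ => mul_ne_add_mul (m := m) (by omega) (by omega) t j h),
    if_neg (show ¬ (1 < m ∧ ∃ j, j < n - 1 ∧ m * t = 2 * m - 2 + m * j) from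
      fun ⟨_, j, _, h⟩ => mul_ne_add_mul (m := m) (r := m - 2) (by omega) (by omega) t (j + 1) (by rw [Nat.mul_succ]; omega))]
  ring

/-- **BULK VALUE at `q ≡ −2 (mod m)`**: `genCount m n 2 (mt + m − 2) = n·C(m,2) + C(n,2)·m²` for `m ≥ 3`, `1 ≤ t`, `t + 2 ≤ n` — the
SAME as at `q ≡ 0` (one proper `X`-pair ·or· two `X`-letters; at `t = 0` only the first: the left-edge value `n·C(m,2)`). -/
theorem genCount_two_bulk_neg_two {m : ℕ} (hm : 3 ≤ m) {n t : ℕ} (ht1 : 1 ≤ t) (ht : t + 2 ≤ n) :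
    genCount m n 2 (m * t + (m - 2)) = n * m.choose 2 + n.choose 2 * (m * m) := by
  rw [genCount_two_closed (by omega),
    if_neg (show ¬ (∃ j, j < n ∧ m * t + (m - 2) = m * j) from
      fun ⟨j, _, h⟩ => mul_ne_add_mul (m := m) (r := m - 2) (by omega) (by omega) j t (by omega)),
    if_pos (show 2 < m ∧ ∃ j, j < n ∧ m * t + (m - 2) = m - 2 + m * j from ⟨by omega, t, by omega, by omega⟩),
    if_neg (show ¬ (∃ j, j < n - 1 ∧ m * t + (m - 2) = m * j) from
      fun ⟨j, _, h⟩ => mul_ne_add_mul (m := m) (r := m - 2) (by omega) (by omega) j t (by omega)),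
    if_neg (show ¬ (1 < m ∧ ∃ j, j < n - 1 ∧ m * t + (m - 2) = m - 1 + m * j) from
      fun ⟨_, j, _, h⟩ => mul_ne_add_mul (m := m) (r := 1) (by omega) (by omega) t j (by omega)),
    if_pos (show 1 < m ∧ ∃ j, j < n - 1 ∧ m * t + (m - 2) = 2 * m - 2 + m * j from
      ⟨by omega, t - 1, by omega, by rw [Nat.mul_sub, mul_one]; have := Nat.mul_le_mul_left m ht1; omega⟩)]
  ring

/-- **BULK VALUE at `q ≡ −1 (mod m)`**: `genCount m n 2 (mt + m − 1) = n(n−1)·m² = 2·C(n,2)·m²` for `m ≥ 2`, `t + 2 ≤ n` (one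
`X`-letter and one `Y`-letter on two blocks); every other residue is `0` (`WedgePointPairPowersPerQResidues`). -/
theorem genCount_two_bulk_neg_one {m : ℕ} (hm : 2 ≤ m) {n t : ℕ} (ht : t + 2 ≤ n) :
    genCount m n 2 (m * t + (m - 1)) = n.choose 2 * (2 * (m * m)) := by
  rw [genCount_two_closed (by omega),
    if_neg (show ¬ (∃ j, j < n ∧ m * t + (m - 1) = m * j) from
      fun ⟨j, _, h⟩ => mul_ne_add_mul (m := m) (r := m - 1) (by omega) (by omega) j t (by omega)),
    if_neg (show ¬ (2 < m ∧ ∃ j, j < n ∧ m * t + (m - 1) = m - 2 + m * j) from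
      fun ⟨_, j, _, h⟩ => mul_ne_add_mul (m := m) (r := 1) (by omega) (by omega) j t (by omega)),
    if_neg (show ¬ (∃ j, j < n - 1 ∧ m * t + (m - 1) = m * j) from
      fun ⟨j, _, h⟩ => mul_ne_add_mul (m := m) (r := m - 1) (by omega) (by omega) j t (by omega)),
    if_pos (show 1 < m ∧ ∃ j, j < n - 1 ∧ m * t + (m - 1) = m - 1 + m * j from ⟨by omega, t, by omega, by omega⟩),
    if_neg (show ¬ (1 < m ∧ ∃ j, j < n - 1 ∧ m * t + (m - 1) = 2 * m - 2 + m * j) from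
      fun ⟨_, j, _, h⟩ => mul_ne_add_mul (m := m) (r := 1) (by omega) (by omega) (j + 1) t (by rw [Nat.mul_succ]; omega))]
  ring

end Summit.Ventures.HSemireg.FormulaN.Uniform

/-! ## §3 (bis). The bulk periodicity as a RANK statement and as th-7's class count -/

open Module

namespace Summit.Ventures.HSemireg.Wedge.PairPowers

open Summit.Ventures.HSemireg.Wedge Summit.Ventures.HSemireg.Wedge.Kunneth

variable (K : Type*) [Field K] {m : ℕ} {n : ℕ}

/-- **THE BULK PERIODICITY THEOREM (rank form).**  For every field `K`, every `m ≥ 1`, `n`, `k`, `a, c ≠ 0` and every block `q` with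
`k(m−1) ≤ q` and `q + m(k+1) ≤ mn`: the blocks `q` and `q + m` of `θ ↦ θ ∧ F` on `⋀^k K^{(m+m)n}` have the SAME rank — one period of the
Dolbeault index further in the bulk, every class reaching `q` is matched by the same class shifted over one more empty block, and no new
shape enters (`u`-degree bound `p(m−1)`). -/
theorem finrank_range_blockProj_wedge_pairBox_add_period (hm : 1 ≤ m) {a c : K} (ha : a ≠ 0) (hc : c ≠ 0) {k q : ℕ}
    (hkq : k * (m - 1) ≤ q) (hq : q + m + m * k ≤ m * n) :
    finrank K (LinearMap.range (blockProj K m n (q + m) ∘ₗ wedge K (Fin ((m + m) * n)) k (pairBox K (m := m) (n := n) a c))) =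
      finrank K (LinearMap.range (blockProj K m n q ∘ₗ wedge K (Fin ((m + m) * n)) k (pairBox K (m := m) (n := n) a c))) := by
  rw [finrank_range_blockProj_wedge_pairBox K hm ha hc, finrank_range_blockProj_wedge_pairBox K hm ha hc,
    FormulaN.Uniform.genCount_add_period hm hkq hq]

/-- class form: the numbers of degree-`k` classes reaching `q` and `q + m` agree in the bulk (`m ≥ 1`). -/
theorem card_Fset_add_period (hm : 1 ≤ m) {k q : ℕ} (hkq : k * (m - 1) ≤ q) (hq : q + m + m * k ≤ m * n) :
    (Fset m n k (q + m)).card = (Fset m n k q).card := by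
  rw [card_Fset hm, card_Fset hm, FormulaN.Uniform.genCount_add_period hm hkq hq]

end Summit.Ventures.HSemireg.Wedge.PairPowers
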